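import Summits.CriticalPhenomena.SAWScalingLimit.Theorems.SAWDevelopingMapObservableToSLETypeLadderCarvedReductionSqueezeLowWindow
import Summits.CriticalPhenomena.SAWScalingLimit.Theorems.SAWDevelopingMapObservableToSLETypeLadderCarvedReductionSqueezeShadow
import HarnessLib

/-!
# The corridor of a window cross-cut: low box under the frame + body zone + exit, one connected
# open set off the bulk (piece (T-A′ P1-corridor) of stub T-A′
# `stub_carvedReduction_squeezeGeometry_domains`)

Crux `SAWDevelopingMap.ObservableToSLE` (stmt-CriticalPhenomena-10472), line `six-class-type-ladder`,
stub T-A′ `stub_carvedReduction_squeezeGeometry_domains`.  Landing target: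
`Summits/CriticalPhenomena/SAWScalingLimit/Theorems/SAWDevelopingMapObservableToSLETypeLadderCarvedReductionSqueezeCorridor.lean`
(`--supports stmt-CriticalPhenomena-10472`; registered carrier `stub_carvedReduction_corridor`).
Sequel of `…SqueezeLowWindow` (`stub_carvedReduction_lowWindow`); its output is the corridor `O i`
of `…SqueezeSuperFrame` (`stub_carvedReduction_superFrame`), its inputs come from
`…SqueezeGateHalfBall` (the limit body `B ∋ P - (ρ/2) i` stays `ρ/4` off the open upper
half-ball of the window) and `…SqueezeConeExit` (the exit zone `F`).

The corridor of the window cross-cut at the gate `P` is the union of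
* the LOW BOX `V ∖ K` under the frame (`V = {|re z - re P| < W₁, im P - H₁ < im z < im P - h}`,
  `K = closedBall (P - h i) ρ'`), which carries the docks of the lowered window;
* the BODY ZONE `Z = {z | infDist z B < r₂}` of the limit body `B` (connected, containing
  `P - (ρ/2) i`, at distance `≥ ρ/4` from the open upper half-ball `{im > im P} ∩ ball P (ρ/2)`);
* an EXIT ZONE `F` (open, connected, inside `J`, off `ball P (ρ/2)`, meeting `Z`).
`stub_carvedReduction_corridor`: under the bookkeeping inequalities on the radii it is open,
connected, inside `J`, contains the docks, and misses the closed frame rectangle, the closed gate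
ball `closedBall P ρw` and the closed lowered disc `K` — the corridor hypotheses of
`stub_carvedReduction_superFrame`.  Tools: `isConnected_infDistZone` (a metric neighbourhood of a
connected set is connected), `le_infDist_near_gate` (points near the closed lower half of the
window are far from `B`).
-/

noncomputable section
open scoped Topology
open Filter Set Metric
open Literature.Probability.RandomPlanarGeometry

namespace Summit.CriticalPhenomena.SAWScalingLimit.Theorems.ObservableToSLE.TypeLadder

/-! ### Metric neighbourhoods of connected sets -/

/-- The open `r`-neighbourhood `{z | infDist z B < r}` is open. -/
theorem isOpen_infDistZone (B : Set ℂ) (r : ℝ) : IsOpen {z : ℂ | infDist z B < r} :=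
  isOpen_lt (continuous_infDist_pt B) continuous_const

/-- **The open `r`-neighbourhood of a connected set is connected** (`0 < r`). -/
theorem isConnected_infDistZone {B : Set ℂ} (hB : IsConnected B) {r : ℝ} (hr : 0 < r) :
    IsConnected {z : ℂ | infDist z B < r} := by
  obtain ⟨b₀, hb₀⟩ := hB.nonempty
  have hBsub : B ⊆ {z : ℂ | infDist z B < r} := fun b hb => by
    show infDist b B < r
    rw [infDist_zero_of_mem hb]; exact hr
  have heq : {z : ℂ | infDist z B < r} = ⋃₀ {S : Set ℂ | ∃ b ∈ B, S = B ∪ ball b r} := by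
    apply Subset.antisymm
    · intro z hz
      obtain ⟨b, hb, hzb⟩ := (infDist_lt_iff ⟨b₀, hb₀⟩).1 hz
      exact ⟨B ∪ ball b r, ⟨b, hb, rfl⟩, Or.inr (mem_ball.2 hzb)⟩
    · rintro z ⟨S, ⟨b, hb, rfl⟩, hz | hz⟩
      · exact hBsub hz
      · show infDist z B < r
        exact (infDist_le_dist_of_mem hb).trans_lt (mem_ball.1 hz)
  rw [heq]
  refine ⟨⟨b₀, B ∪ ball b₀ r, ⟨b₀, hb₀, rfl⟩, Or.inl hb₀⟩, isPreconnected_sUnion b₀ _ ?_ ?_⟩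
  · rintro S ⟨b, hb, rfl⟩
    exact Or.inl hb₀
  · rintro S ⟨b, hb, rfl⟩
    exact (hB.union ⟨b, hb, mem_ball_self hr⟩
      ((convex_ball b r).isPathConnected ⟨b, mem_ball_self hr⟩).isConnected).isPreconnected

/-- Bounded body, bounded zone: `B ⊆ closedBall c R'` gives `{infDist · B < r} ⊆ ball c (R' + r)`. -/
theorem infDistZone_subset_ball {B : Set ℂ} {c : ℂ} {R' r : ℝ} (hB : B ⊆ closedBall c R') (hBne : B.Nonempty) :
    {z : ℂ | infDist z B < r} ⊆ ball c (R' + r) := by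
  intro z hz
  obtain ⟨b, hb, hzb⟩ := (infDist_lt_iff hBne).1 hz
  rw [mem_ball]
  calc dist z c ≤ dist z b + dist b c := dist_triangle _ _ _
    _ < r + R' := add_lt_add_of_lt_of_le hzb (mem_closedBall.1 (hB hb))
    _ = R' + r := add_comm _ _

/-! ### Points near the closed lower half of the window are far from the body -/

/-- **Distance to the body near the gate.**  If `B` stays at distance `≥ m` from the open upper
half-ball `{im > im P} ∩ ball P R₁`, then a point `w` with `|re w - re P| + |im w - im P| < R₁`
has `infDist w B ≥ m - max (im P - im w) 0` (its depth below the line is all it can lose). -/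
theorem le_infDist_near_gate {B : Set ℂ} {P : ℂ} {R₁ m : ℝ}
    (hBfar : ∀ b ∈ B, ∀ z : ℂ, dist z P < R₁ → P.im < z.im → m ≤ dist b z) (hBne : B.Nonempty)
    {w : ℂ} (hw : |w.re - P.re| + |w.im - P.im| < R₁) : m - max (P.im - w.im) 0 ≤ infDist w B := by
  rw [le_infDist hBne]
  intro b hb
  refine le_of_forall_pos_lt_add fun ε hε => ?_
  set ε' : ℝ := min ε (R₁ - (|w.re - P.re| + |w.im - P.im|)) / 2 with hε'
  have hε'0 : 0 < ε' := by rw [hε']; exact half_pos (lt_min hε (by linarith))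
  have hε'1 : ε' < ε := by
    have := min_le_left ε (R₁ - (|w.re - P.re| + |w.im - P.im|)); rw [hε']; linarith
  have hε'2 : |w.re - P.re| + |w.im - P.im| + ε' < R₁ := by
    have := min_le_right ε (R₁ - (|w.re - P.re| + |w.im - P.im|)); rw [hε']; linarith
  set z : ℂ := ⟨w.re, max w.im P.im + ε'⟩ with hz
  have hzim : P.im < z.im := by
    show P.im < max w.im P.im + ε'
    linarith [le_max_right w.im P.im]
  have hmax : max w.im P.im - P.im ≤ |w.im - P.im| :=
    sub_le_iff_le_add.2 (max_le (by linarith [le_abs_self (w.im - P.im)]) (by linarith [abs_nonneg (w.im - P.im)]))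
  have hzP : dist z P < R₁ := by
    refine (dist_le_abs_re_add_abs_im z P).trans_lt ?_
    have h1 : (z - P).re = w.re - P.re := by simp [hz]
    have h2 : (z - P).im = max w.im P.im + ε' - P.im := by simp [hz]
    rw [h1, h2, abs_of_pos (by linarith [le_max_right w.im P.im] : 0 < max w.im P.im + ε' - P.im)]
    linarith
  have hwz : dist w z = max (P.im - w.im) 0 + ε' := by
    rw [dist_comm, dist_eq_norm]
    have : z - w = ((max w.im P.im + ε' - w.im : ℝ) : ℂ) * Complex.I := by
      apply Complex.ext <;> simp [hz]
    rw [this, norm_mul, Complex.norm_I, mul_one, Complex.norm_real,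
      Real.norm_of_nonneg (by linarith [le_max_left w.im P.im])]
    have : max w.im P.im - w.im = max (P.im - w.im) 0 := by
      rcases le_total w.im P.im with h | h
      · rw [max_eq_right h, max_eq_left (by linarith)]
      · rw [max_eq_left h, max_eq_right (by linarith)]; ring
    linarith
  have := hBfar b hb z hzP hzim
  have htri : dist b z ≤ dist w b + dist w z := by rw [dist_comm w b]; exact dist_triangle _ _ _
  linarith

/-! ### The corridor -/

/-- **Registered carrier `stub_carvedReduction_corridor`** (crux item stmt-CriticalPhenomena-10472,
stub T-A′ `stub_carvedReduction_squeezeGeometry_domains`, piece THE CORRIDOR OF A WINDOW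
CROSS-CUT); see the module docstring.  Bookkeeping: `0 < ρw ≤ h`, `0 < ρ' < W₁`,
`h + ρ' < H₁`, `W₁ + H₁ ≤ ρ/2`, `2 ρ' + h < ρ/2`, `0 < r₂ ≤ ρ/4 - (h + ρ')`, `ρ/2 - r₂ < H₁`. -/
theorem stub_carvedReduction_corridor :
    ∀ (J B F : Set ℂ) (P : ℂ) (ρ ρ' h ρw W₁ H₁ r₂ : ℝ),
      0 < ρw → ρw ≤ h → 0 < ρ' → ρ' < W₁ → h + ρ' < H₁ → W₁ + H₁ ≤ ρ / 2 → 2 * ρ' + h < ρ / 2 →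
      0 < r₂ → r₂ ≤ ρ / 4 - (h + ρ') → ρ / 2 - r₂ < H₁ →
      ball P (ρ / 2) ⊆ J → IsConnected B → P - ((ρ / 2 : ℝ) : ℂ) * Complex.I ∈ B →
      (∀ b ∈ B, ∀ z : ℂ, dist z P < ρ / 2 → P.im < z.im → ρ / 4 ≤ dist b z) →
      {z : ℂ | infDist z B < r₂} ⊆ J →
      IsOpen F → IsConnected F → F ⊆ J → Disjoint F (ball P (ρ / 2)) → (F ∩ {z : ℂ | infDist z B < r₂}).Nonempty →
      IsOpen (({z : ℂ | |z.re - P.re| < W₁ ∧ P.im - H₁ < z.im ∧ z.im < P.im - h} \ closedBall (P - h * Complex.I) ρ') ∪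
          {z : ℂ | infDist z B < r₂} ∪ F) ∧
      IsConnected (({z : ℂ | |z.re - P.re| < W₁ ∧ P.im - H₁ < z.im ∧ z.im < P.im - h} \ closedBall (P - h * Complex.I) ρ') ∪
          {z : ℂ | infDist z B < r₂} ∪ F) ∧
      ({z : ℂ | |z.re - P.re| < W₁ ∧ P.im - H₁ < z.im ∧ z.im < P.im - h} \ closedBall (P - h * Complex.I) ρ') ∪
          {z : ℂ | infDist z B < r₂} ∪ F ⊆ J ∧
      Disjoint (({z : ℂ | |z.re - P.re| < W₁ ∧ P.im - H₁ < z.im ∧ z.im < P.im - h} \ closedBall (P - h * Complex.I) ρ') ∪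
          {z : ℂ | infDist z B < r₂} ∪ F) {z : ℂ | |z.re - P.re| ≤ ρ' ∧ P.im - h ≤ z.im ∧ z.im ≤ P.im} ∧
      Disjoint (({z : ℂ | |z.re - P.re| < W₁ ∧ P.im - H₁ < z.im ∧ z.im < P.im - h} \ closedBall (P - h * Complex.I) ρ') ∪
          {z : ℂ | infDist z B < r₂} ∪ F) (closedBall P ρw) ∧
      Disjoint (({z : ℂ | |z.re - P.re| < W₁ ∧ P.im - H₁ < z.im ∧ z.im < P.im - h} \ closedBall (P - h * Complex.I) ρ') ∪
          {z : ℂ | infDist z B < r₂} ∪ F) (closedBall (P - h * Complex.I) ρ') ∧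
      segment ℝ (P - h * Complex.I - ρ') (P - h * Complex.I - ρ' - ((ρ' / 2 : ℝ) : ℂ) * Complex.I) \
          {P - h * Complex.I - ρ'} ⊆
        ({z : ℂ | |z.re - P.re| < W₁ ∧ P.im - H₁ < z.im ∧ z.im < P.im - h} \ closedBall (P - h * Complex.I) ρ') ∪
          {z : ℂ | infDist z B < r₂} ∪ F ∧
      segment ℝ (P - h * Complex.I + ρ') (P - h * Complex.I + ρ' - ((ρ' / 2 : ℝ) : ℂ) * Complex.I) \
          {P - h * Complex.I + ρ'} ⊆
        ({z : ℂ | |z.re - P.re| < W₁ ∧ P.im - H₁ < z.im ∧ z.im < P.im - h} \ closedBall (P - h * Complex.I) ρ') ∪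
          {z : ℂ | infDist z B < r₂} ∪ F ∧
      Disjoint (({z : ℂ | |z.re - P.re| < W₁ ∧ P.im - H₁ < z.im ∧ z.im < P.im - h} \ closedBall (P - h * Complex.I) ρ') ∪
          {z : ℂ | infDist z B < r₂} ∪ F) ({z : ℂ | P.im < z.im} ∩ ball P (ρ / 2)) := by
  intro J B F P ρ ρ' h ρw W₁ H₁ r₂ hρw hρwh hρ' hW hH hWH hρ'h hr₂ hr₂' hHr hballJ hBc hgB hBfar hZJ hFo hFc hFJ hFball
    hFZ
  have hh : 0 < h := hρw.trans_le hρwh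
  have hρ : 0 < ρ := by linarith
  obtain ⟨hVo, hVc, hdL, hdR, hVlow, hVR, hVB, hVK⟩ := stub_carvedReduction_lowWindow P ρ' h W₁ H₁ hρ' hh hW hH
  set V : Set ℂ := {z : ℂ | |z.re - P.re| < W₁ ∧ P.im - H₁ < z.im ∧ z.im < P.im - h} \
    closedBall (P - h * Complex.I) ρ' with hV
  set Z : Set ℂ := {z : ℂ | infDist z B < r₂} with hZ
  have hBne : B.Nonempty := ⟨_, hgB⟩
  -- the low box lies in the closed lower half of `ball P (ρ/2)`
  have hVball : V ⊆ ball P (ρ / 2) := by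
    rintro z ⟨⟨hre, him1, him2⟩, -⟩
    rw [mem_ball]
    refine (dist_le_abs_re_add_abs_im z P).trans_lt ?_
    rw [Complex.sub_re, Complex.sub_im, abs_of_neg (by linarith : z.im - P.im < 0)]
    linarith
  -- points of the zone are deep or far: depth control via `le_infDist_near_gate`
  have hfar : ∀ w : ℂ, |w.re - P.re| + |w.im - P.im| < ρ / 2 → P.im - w.im ≤ ρ / 4 - r₂ → w ∉ Z := by
    intro w hw hdepth hwZ
    have h1 := le_infDist_near_gate hBfar hBne hw
    have h2 : max (P.im - w.im) 0 ≤ ρ / 4 - r₂ := max_le hdepth (by linarith)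
    have h3 : infDist w B < r₂ := hwZ
    linarith
  -- the pieces are connected and overlap
  have hZo : IsOpen Z := isOpen_infDistZone B r₂
  have hZc : IsConnected Z := isConnected_infDistZone hBc hr₂
  set t₀ : ℝ := (max (h + ρ') (ρ / 2 - r₂) + H₁) / 2 with ht₀
  have ht₀1 : h + ρ' < t₀ := by
    have := le_max_left (h + ρ') (ρ / 2 - r₂); rw [ht₀]; linarith
  have ht₀2 : ρ / 2 - r₂ < t₀ := by
    have := le_max_right (h + ρ') (ρ / 2 - r₂); rw [ht₀]; linarith
  have ht₀3 : t₀ < H₁ := by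
    have := max_lt hH hHr; rw [ht₀]; linarith
  set w₀ : ℂ := P - t₀ * Complex.I with hw₀
  have hw₀re : w₀.re = P.re := by simp [hw₀]
  have hw₀im : w₀.im = P.im - t₀ := by simp [hw₀]
  have hw₀V : w₀ ∈ V := by
    refine ⟨⟨by rw [hw₀re]; simp; linarith, by rw [hw₀im]; linarith, by rw [hw₀im]; linarith⟩, fun hK => ?_⟩
    rw [mem_closedBall, dist_eq_norm] at hK
    have : w₀ - (P - ↑h * Complex.I) = -(((t₀ - h : ℝ) : ℂ) * Complex.I) := by
      rw [hw₀]; push_cast; ring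
    rw [this, norm_neg, norm_mul, Complex.norm_real, Complex.norm_I, mul_one,
      Real.norm_of_nonneg (by linarith)] at hK
    linarith
  have hw₀Z : w₀ ∈ Z := by
    show infDist w₀ B < r₂
    refine (infDist_le_dist_of_mem hgB).trans_lt ?_
    rw [dist_eq_norm]
    have : w₀ - (P - ((ρ / 2 : ℝ) : ℂ) * Complex.I) = (((ρ / 2 - t₀ : ℝ)) : ℂ) * Complex.I := by
      rw [hw₀]; push_cast; ring
    rw [this, norm_mul, Complex.norm_real, Complex.norm_I, mul_one, Real.norm_eq_abs, abs_lt]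
    constructor <;> linarith
  have hconn : IsConnected (V ∪ Z ∪ F) := by
    have h1 : IsConnected (V ∪ Z) := hVc.union ⟨w₀, hw₀V, hw₀Z⟩ hZc
    obtain ⟨f₀, hf₀F, hf₀Z⟩ := hFZ
    exact h1.union ⟨f₀, Or.inr hf₀Z, hf₀F⟩ hFc
  refine ⟨(hVo.union hZo).union hFo, hconn, union_subset (union_subset (hVball.trans hballJ) hZJ) hFJ,
    ?_, ?_, ?_, fun z hz => Or.inl (Or.inl (hdL hz)), fun z hz => Or.inl (Or.inl (hdR hz)), ?_⟩
  · -- the closed frame rectangle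
    refine Set.disjoint_left.2 ?_
    rintro z ((hz | hz) | hz) hzR
    · exact Set.disjoint_left.1 hVR hz hzR
    · refine hfar z ?_ ?_ hz
      · have h1 : |z.im - P.im| ≤ h := by rw [abs_le]; constructor <;> linarith [hzR.2.1, hzR.2.2]
        linarith [hzR.1]
      · linarith [hzR.2.1]
    · refine Set.disjoint_left.1 hFball hz (mem_ball.2 ?_)
      refine (dist_le_abs_re_add_abs_im z P).trans_lt ?_
      rw [Complex.sub_re, Complex.sub_im]
      have h1 : |z.im - P.im| ≤ h := by rw [abs_le]; constructor <;> linarith [hzR.2.1, hzR.2.2]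
      linarith [hzR.1]
  · -- the closed gate ball
    refine Set.disjoint_left.2 ?_
    rintro z ((hz | hz) | hz) hzB
    · exact Set.disjoint_left.1 (hVB ρw hρwh) hz hzB
    · have hzB' := mem_closedBall.1 hzB
      have hre : |z.re - P.re| ≤ ρw := by
        rw [← Complex.sub_re]; exact (Complex.abs_re_le_norm _).trans (by rwa [← dist_eq_norm])
      have him : |z.im - P.im| ≤ ρw := by
        rw [← Complex.sub_im]; exact (Complex.abs_im_le_norm _).trans (by rwa [← dist_eq_norm])
      refine hfar z (by linarith) ?_ hz
      linarith [neg_abs_le (z.im - P.im)]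
    · exact Set.disjoint_left.1 hFball hz (mem_ball.2 (lt_of_le_of_lt (mem_closedBall.1 hzB) (by linarith)))
  · -- the closed lowered disc
    refine Set.disjoint_left.2 ?_
    rintro z ((hz | hz) | hz) hzK
    · exact Set.disjoint_left.1 hVK hz hzK
    · have hzK' := mem_closedBall.1 hzK
      have hre := (re_le_dist_lowCentre (P := P) (h := h) z).trans hzK'
      have him := (im_le_dist_lowCentre (P := P) (h := h) z).trans hzK'
      refine hfar z ?_ ?_ hz
      · have : |z.im - P.im| ≤ h + ρ' := by
          rw [abs_le] at him ⊢; constructor <;> linarith [him.1, him.2]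
        linarith
      · rw [abs_le] at him; linarith [him.1]
    · refine Set.disjoint_left.1 hFball hz (mem_ball.2 ?_)
      calc dist z P ≤ dist z (P - h * Complex.I) + dist (P - h * Complex.I) P := dist_triangle _ _ _
        _ ≤ ρ' + h := by
          refine add_le_add (mem_closedBall.1 hzK) ?_
          rw [dist_eq_norm, show P - ↑h * Complex.I - P = -(↑h * Complex.I) by ring, norm_neg, norm_mul,
            Complex.norm_real, Complex.norm_I, mul_one, Real.norm_of_nonneg hh.le]
        _ < ρ / 2 := by linarith
  · -- the open upper half-ball (the bulk near the gate)
    refine Set.disjoint_left.2 ?_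
    rintro z ((hz | hz) | hz) ⟨hzim, hzb⟩
    · have := hVlow hz
      simp only [mem_setOf_eq] at this hzim
      linarith
    · have hzb' := mem_ball.1 hzb
      obtain ⟨b, hb, hzb''⟩ := (infDist_lt_iff hBne).1 (show infDist z B < r₂ from hz)
      have := hBfar b hb z hzb' hzim
      rw [dist_comm] at hzb''
      linarith
    · exact Set.disjoint_left.1 hFball hz hzb

end Summit.CriticalPhenomena.SAWScalingLimit.Theorems.ObservableToSLE.TypeLadder

end
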